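import Literature.Combinatorics.Extremal.LinesOnPlaneCurve
import Literature.Computability.AlgebraicComplexity.DeterminantalConormalBoundPlane
import Literature.RingTheory.MvPolynomial.BihomogeneousCoefficients
import Mathlib.LinearAlgebra.CrossProduct
import HarnessLib

/-!
# At most `ab` lines on two surfaces without common component (Bézout for lines in 3-space)

Topic `Literature/Combinatorics/Extremal` (lines on algebraic surfaces). Everything in this file
is PROVED.

**Theorem** (`card_lines_on_two_surfaces_le`). *Let `K` be an infinite field and let
`f, g ∈ K[X₀,X₁,X₂]` be relatively prime (no common non-unit factor) of total degrees `a`, `b`.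
Then every finite set of lines of `K³` lying (pointwise) on `{f = 0} ∩ {g = 0}` has at most
`a b` elements.*

This is [Kollar2015, Proposition 14 (1)] ("`C = S ∩ T` has at most `ab` irreducible
components") restricted to line components and stated affinely — the form in which it enters the
theory of lines on surfaces (a non-ruled surface `S` of degree `d` together with its flecnodal
surface `T` of degree `11d - 24` carries at most `d(11d-24)` lines, [Kollar2015, Cor. 21 (1)];
Guth–Katz use the same count). Kollár's proof is Bézout for `S, T` and a general hyperplane; the
proof here is the affine, elimination-theoretic version of the same idea, avoiding intersection
multiplicities:

1. (`totalDegree_resultant_le`) the isobaric degree bound for the Sylvester resultant: if the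
   `Yⁱ`-coefficients of `F, H ∈ R[τ][Y]` have total degree `≤ e - i`, `≤ e' - i`, then
   `deg Res_{e,e'}(F, H) ≤ e e'` (companion of the tree's `isHomogeneous_resultant`,
   [Gibson1998, Lemma 14.3]);
2. after a general linear change of coordinates (`f` monic in `X₀`, no line of the family
   parallel to the `X₀`-axis, no two lines of the family in a common plane parallel to the
   `X₀`-axis), the resultant `R = Res_{X₀}(f, g) ∈ K[X₁,X₂]` is non-zero
   (`resultant_ne_zero_of_isRelPrime`, the surfaces have no common component), has degree
   `≤ ab`, and vanishes on the projection of every line of the family — a family of DISTINCT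
   lines of the plane;
3. a non-zero plane curve of degree `≤ ab` contains at most `ab` lines
   (`card_lines_le_totalDegree`).

## References
* [Kollar2015] J. Kollár, *Szemerédi–Trotter-type theorems in dimension 3*, Adv. Math. 271
  (2015), Proposition 14 (1) and its proof ("Using [Bézout] for `S, T` and a general hyperplane
  we see that `C` has degree `≤ ab`, thus `≤ ab` irreducible components"), Corollary 21 (1).
* [Gibson1998] C. G. Gibson, *Elementary Geometry of Algebraic Curves*, CUP 1998, §14.3.
-/

namespace Literature.Combinatorics.Extremal

open MvPolynomial Finset Matrix
open scoped Matrix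
open Literature.Computability.AlgebraicComplexity.DeterminantalConormal
  (sylvester_castAdd sylvester_natAdd resultant_ne_zero_of_isRelPrime
    eval_resultant_eq_zero_of_common_zero isRelPrime_map_mulEquiv eval_linSubst
    isRelPrime_linSubst exists_point_eval_ne_zero eval_linForm linForm_ne_zero)
open Literature.RingTheory.MvPolynomial (eval_smul_of_isHomogeneous)

/-! ### The degree of the resultant -/

section Resultant

open Polynomial

variable {R : Type*} [CommRing R] {τ : Type*}

/-- Degree bound for the entries of the Sylvester matrix: if `deg (F.coeff i) ≤ e - i` and
`deg (H.coeff i) ≤ e' - i`, the entry `(r, c)` of `Syl_{e,e'}(F, H)` has total degree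
`≤ w(c) - r`, `w(c) = e' + c` on the first `e` columns and `w(c) = c` on the last `e'` ones.
[cite: Gibson1998, §14.3 Lemma 14.3 (proof)] -/
theorem totalDegree_sylvester_le {F H : Polynomial (MvPolynomial τ R)} {e e' : ℕ}
    (hF : ∀ i, (F.coeff i).totalDegree ≤ e - i) (hH : ∀ i, (H.coeff i).totalDegree ≤ e' - i)
    (r c : Fin (e + e')) :
    (sylvester F H e e' r c).totalDegree ≤ (if (c : ℕ) < e then e' + c else c) - r := by
  induction c using Fin.addCases with
  | left j =>
    rw [sylvester_castAdd, Fin.val_castAdd, if_pos j.isLt]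
    split_ifs with h
    · refine (hH _).trans ?_
      omega
    · rw [totalDegree_zero]
      exact Nat.zero_le _
  | right j =>
    rw [sylvester_natAdd, Fin.val_natAdd, if_neg (show ¬ (e + (j : ℕ) < e) by omega)]
    split_ifs with h
    · refine (hF _).trans ?_
      omega
    · rw [totalDegree_zero]
      exact Nat.zero_le _

/-- **Isobaric degree bound for the resultant.** If the `Yⁱ`-coefficient of `F ∈ R[τ][Y]` has
total degree `≤ e - i` and that of `H` has total degree `≤ e' - i` (as when `F, H` come from
polynomials of total degrees `≤ e, ≤ e'` in `τ ⊔ {Y}`), then `Res_{e,e'}(F, H) ∈ R[τ]` has total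
degree `≤ e e'` (expand the Sylvester determinant; every permutation term has degree `≤ e e'`).
[cite: Gibson1998, §14.3 Lemma 14.3] -/
theorem totalDegree_resultant_le {F H : Polynomial (MvPolynomial τ R)} {e e' : ℕ}
    (hF : ∀ i, (F.coeff i).totalDegree ≤ e - i) (hH : ∀ i, (H.coeff i).totalDegree ≤ e' - i) :
    (resultant F H e e').totalDegree ≤ e * e' := by
  classical
  set w : Fin (e + e') → ℕ := fun c => if (c : ℕ) < e then e' + c else c with hw
  have hwsum : ∑ c, w c = e * e' + ∑ c : Fin (e + e'), (c : ℕ) := by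
    have h2 : ∀ j : Fin e', ¬ (e + (j : ℕ) < e) := fun j => by omega
    simp only [hw, Fin.sum_univ_add, Fin.val_castAdd, Fin.val_natAdd, Fin.is_lt, if_true, h2,
      if_false, Finset.sum_add_distrib, Finset.sum_const, Finset.card_univ, Fintype.card_fin,
      smul_eq_mul]
    ring
  rw [resultant, Matrix.det_apply']
  refine (totalDegree_finsetSum _ _).trans (Finset.sup_le fun σ _ => ?_)
  rw [← map_intCast (C : R →+* MvPolynomial τ R)]
  refine (totalDegree_mul _ _).trans ?_
  rw [totalDegree_C, zero_add]
  by_cases hσ : ∀ c, ((σ c : Fin (e + e')) : ℕ) ≤ w c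
  · refine (totalDegree_finsetProd _ _).trans ?_
    have hdeg : ∑ c, (w c - ((σ c : Fin (e + e')) : ℕ)) = e * e' := by
      have h1 : ∑ c, (w c - ((σ c : Fin (e + e')) : ℕ)) + ∑ c, ((σ c : Fin (e + e')) : ℕ) =
          ∑ c, w c := by
        rw [← Finset.sum_add_distrib]
        exact Finset.sum_congr rfl fun c _ => Nat.sub_add_cancel (hσ c)
      have h2 : ∑ c, ((σ c : Fin (e + e')) : ℕ) = ∑ c : Fin (e + e'), (c : ℕ) :=
        Equiv.sum_comp σ (fun c => (c : ℕ))
      omega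
    rw [← hdeg]
    exact Finset.sum_le_sum fun c _ => totalDegree_sylvester_le hF hH (σ c) c
  · push Not at hσ
    obtain ⟨c, hc⟩ := hσ
    rw [Finset.prod_eq_zero (f := fun i => sylvester F H e e' (σ i) i) (Finset.mem_univ c)
      (Literature.Computability.AlgebraicComplexity.DeterminantalConormal.sylvester_eq_zero_of_lt
        F H e e' (σ c) c hc), totalDegree_zero]
    exact Nat.zero_le _

end Resultant

/-! ### Small linear-algebra facts in `K³` -/

section LinAlg

variable {K : Type*} [Field K]

/-- Linear dependence on a nonzero vector: if `v ≠ 0` and `v, x` are dependent then `x = κ v`.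
[folklore] -/
theorem exists_eq_smul_of_not_linearIndependent {V : Type*} [AddCommGroup V] [Module K V]
    {v x : V} (hv : v ≠ 0) (h : ¬ LinearIndependent K ![v, x]) : ∃ κ : K, x = κ • v := by
  rw [LinearIndependent.pair_iff] at h
  push Not at h
  obtain ⟨a, b, hab, hne⟩ := h
  have hb : b ≠ 0 := by
    intro hb0
    rw [hb0, zero_smul, add_zero, smul_eq_zero] at hab
    rcases hab with ha | hv0
    · exact hne ha hb0
    · exact hv hv0
  refine ⟨-(a / b), ?_⟩
  have h1 : b • x = -(a • v) := eq_neg_of_add_eq_zero_right hab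
  calc x = b⁻¹ • (b • x) := by rw [smul_smul, inv_mul_cancel₀ hb, one_smul]
    _ = -(a / b) • v := by rw [h1, smul_neg, smul_smul, ← neg_smul, div_eq_inv_mul]

/-- Two parametrized lines `{u + t w}`, `{u' + t w'}` with `w' ∥ w` and `u' - u ∥ w` are equal.
[folklore] -/
theorem line_eq_of_parallel {V : Type*} [AddCommGroup V] [Module K V]
    {ℓ m : AffineSubspace K V} {u w u' w' : V} (hw' : w' ≠ 0)
    (hℓ : ∀ z, z ∈ ℓ ↔ ∃ t : K, z = u + t • w) (hℓd : ℓ.direction = K ∙ w)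
    (hm : ∀ z, z ∈ m ↔ ∃ t : K, z = u' + t • w') (hmd : m.direction = K ∙ w')
    {κ β : K} (hκ : w' = κ • w) (hβ : u' - u = β • w) : ℓ = m := by
  have hκ0 : κ ≠ 0 := by
    rintro rfl
    rw [zero_smul] at hκ
    exact hw' hκ
  refine AffineSubspace.ext_of_direction_eq ?_ ⟨u', (hℓ u').2 ⟨β, ?_⟩, (hm u').2 ⟨0, by simp⟩⟩
  · rw [hℓd, hmd, hκ]
    refine le_antisymm ?_ ?_
    · rw [Submodule.span_singleton_le_iff_mem, Submodule.mem_span_singleton]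
      exact ⟨κ⁻¹, by rw [smul_smul, inv_mul_cancel₀ hκ0, one_smul]⟩
    · rw [Submodule.span_singleton_le_iff_mem]
      exact Submodule.smul_mem _ _ (Submodule.mem_span_singleton_self w)
  · calc u' = u + (u' - u) := by abel
      _ = u + β • w := by rw [hβ]

end LinAlg

/-! ### Bézout for lines on two surfaces -/

section TwoSurfaces

variable {K : Type*} [Field K]

open scoped Classical in
/-- **At most `ab` lines lie on two surfaces without common component** ([Kollar2015,
Prop. 14 (1)] for line components, affine form): if `f, g ∈ K[X₀,X₁,X₂]` (`K` infinite) are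
relatively prime of total degrees `a, b`, then a finite set of lines of `K³` lying on
`{f = 0} ∩ {g = 0}` has at most `a b` elements. Proof: after a general linear change of
coordinates, project along the `X₀`-axis; the resultant `Res_{X₀}(f, g)` is a non-zero plane
curve of degree `≤ ab` containing the (distinct) projections of the lines.
[cite: Kollar2015, Proposition 14 (1)] -/
theorem card_lines_on_two_surfaces_le [Infinite K] {f g : MvPolynomial (Fin 3) K}
    (hrel : IsRelPrime f g) (Λ : Finset (AffineSubspace K (Fin 3 → K)))
    (hΛ1 : ∀ ℓ ∈ Λ, Module.finrank K ℓ.direction = 1)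
    (hΛf : ∀ ℓ ∈ Λ, ∀ z ∈ ℓ, eval z f = 0) (hΛg : ∀ ℓ ∈ Λ, ∀ z ∈ ℓ, eval z g = 0) :
    Λ.card ≤ f.totalDegree * g.totalDegree := by
  -- parametrizations `ℓ = {u + t w}` with `ℓ.direction = K ∙ w`
  have hpar := fun ℓ (hℓ : ℓ ∈ Λ) => exists_point_dir_of_finrank_eq_one ℓ (hΛ1 ℓ hℓ)
  choose! uw huw0 hmem hdir using hpar
  -- nothing to do for `Λ = ∅`
  rcases Λ.eq_empty_or_nonempty with hΛe | ⟨ℓ₀, hℓ₀⟩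
  · rw [hΛe, card_empty]
    exact Nat.zero_le _
  set a := f.totalDegree with ha_def
  set b := g.totalDegree with hb_def
  -- `f ≠ 0` and `f` is not constant: a point of `ℓ₀` is a common zero
  have hfz : eval (uw ℓ₀).1 f = 0 :=
    hΛf ℓ₀ hℓ₀ _ ((hmem ℓ₀ hℓ₀ _).2 ⟨0, by rw [zero_smul, add_zero]⟩)
  have hgz : eval (uw ℓ₀).1 g = 0 :=
    hΛg ℓ₀ hℓ₀ _ ((hmem ℓ₀ hℓ₀ _).2 ⟨0, by rw [zero_smul, add_zero]⟩)
  have hf0 : f ≠ 0 := by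
    intro h0
    rw [h0, isRelPrime_zero_left] at hrel
    obtain ⟨c, hc, hgc⟩ := MvPolynomial.isUnit_iff_eq_C_of_isReduced.1 hrel
    rw [hgc, eval_C] at hgz
    exact hc.ne_zero hgz
  have ha0 : a ≠ 0 := by
    intro h0
    have hfC : f = C (coeff 0 f) := totalDegree_eq_zero_iff_eq_C.1 h0
    rw [hfC, eval_C] at hfz
    exact hf0 (by rw [hfC, hfz, C_0])
  -- the top form `fa` of `f` is a nonzero form of degree `a`
  set fa := homogeneousComponent a f with hfa
  have hfahom : fa.IsHomogeneous a := homogeneousComponent_isHomogeneous a f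
  have hfa0 : fa ≠ 0 := by
    obtain ⟨m, hm, hmdeg⟩ : ∃ m ∈ f.support, (m.sum fun _ e => e) = f.totalDegree := by
      obtain ⟨m, hm, h⟩ := Finset.exists_mem_eq_sup f.support (support_nonempty.2 hf0)
        (fun s => s.sum fun _ e => e)
      exact ⟨m, hm, h.symm⟩
    intro h0
    have := congrArg (coeff m) h0
    rw [hfa, coeff_homogeneousComponent, coeff_zero, if_pos] at this
    · exact (mem_support_iff.1 hm) this
    · rw [Finsupp.degree_eq_sum]
      rw [Finsupp.sum_fintype _ _ (fun _ => rfl)] at hmdeg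
      rw [hmdeg]
  /- Step A: a general direction `c`: `fa(c) ≠ 0`, `c` not parallel to any line of `Λ`, and
    `c` off the plane `E(ℓ, m)` attached to every pair of distinct lines (`span(w_ℓ, w_m)` if the
    directions are independent, `span(w_ℓ, u_m - u_ℓ)` for distinct parallel lines). -/
  -- a nonzero vector orthogonal to each direction (Mathlib `exists_ne_zero_dotProduct_eq_zero`)
  have hψ : ∀ ℓ ∈ Λ, ∃ ψ : Fin 3 → K, ψ ≠ 0 ∧ ψ ⬝ᵥ (uw ℓ).2 = 0 := fun ℓ _ =>
    exists_ne_zero_dotProduct_eq_zero _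
  choose! ψ hψ0 hψw using hψ
  -- distinct lines with parallel directions: `w_ℓ` and `u_m - u_ℓ` are independent
  have hpar_ind : ∀ ℓ ∈ Λ, ∀ m ∈ Λ, ℓ ≠ m → ¬ LinearIndependent K ![(uw ℓ).2, (uw m).2] →
      LinearIndependent K ![(uw ℓ).2, (uw m).1 - (uw ℓ).1] := by
    intro ℓ hℓ m hm hne hdep
    by_contra hdep'
    obtain ⟨κ, hκ⟩ := exists_eq_smul_of_not_linearIndependent (huw0 ℓ hℓ) hdep
    obtain ⟨β, hβ⟩ := exists_eq_smul_of_not_linearIndependent (huw0 ℓ hℓ) hdep'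
    exact hne (line_eq_of_parallel (huw0 m hm) (hmem ℓ hℓ) (hdir ℓ hℓ) (hmem m hm) (hdir m hm)
      hκ hβ)
  set φ : AffineSubspace K (Fin 3 → K) × AffineSubspace K (Fin 3 → K) → (Fin 3 → K) :=
    fun p => if LinearIndependent K ![(uw p.1).2, (uw p.2).2] then (uw p.1).2 ⨯₃ (uw p.2).2
      else (uw p.1).2 ⨯₃ ((uw p.2).1 - (uw p.1).1) with hφ_def
  have hφ0 : ∀ p ∈ Λ.offDiag, φ p ≠ 0 := by
    intro p hp
    obtain ⟨h1, h2, hne⟩ := Finset.mem_offDiag.1 hp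
    simp only [hφ_def]
    split_ifs with hind
    · exact crossProduct_ne_zero_iff_linearIndependent.2 hind
    · exact crossProduct_ne_zero_iff_linearIndependent.2 (hpar_ind _ h1 _ h2 hne hind)
  have hP : fa * (∏ ℓ ∈ Λ, ∑ i, C (ψ ℓ i) * X i) *
      (∏ p ∈ Λ.offDiag, ∑ i, C (φ p i) * X i) ≠ 0 := by
    refine mul_ne_zero (mul_ne_zero hfa0 ?_) ?_
    · exact Finset.prod_ne_zero_iff.2 fun ℓ hℓ => linForm_ne_zero (hψ0 ℓ hℓ)
    · exact Finset.prod_ne_zero_iff.2 fun p hp => linForm_ne_zero (hφ0 p hp)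
  obtain ⟨c, hc⟩ := exists_point_eval_ne_zero hP
  rw [map_mul, map_mul, map_prod, map_prod, mul_ne_zero_iff, mul_ne_zero_iff,
    Finset.prod_ne_zero_iff, Finset.prod_ne_zero_iff] at hc
  obtain ⟨⟨hca, hcψ⟩, hcφ⟩ := hc
  simp only [eval_linForm] at hcψ hcφ
  have hc0 : c ≠ 0 := by
    rintro rfl
    apply hca
    have := eval_smul_of_isHomogeneous hfahom (0 : K) (0 : Fin 3 → K)
    rwa [zero_smul, zero_pow ha0, zero_mul] at this
  /- Step B: coordinates with first basis vector `c`: `f' = f ∘ B`, `g' = g ∘ B`. -/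
  obtain ⟨M, hM, hMrow⟩ := exists_matrix_row_zero_eq hc0
  set B : Matrix (Fin 3) (Fin 3) K := Mᵀ with hB
  have hBdet : IsUnit B.det := by rwa [hB, Matrix.det_transpose]
  have hBcol : B *ᵥ (Pi.single 0 1 : Fin 3 → K) = c := by
    rw [Matrix.mulVec_single_one]
    funext i
    rw [Matrix.col_apply, hB, Matrix.transpose_apply, hMrow]
  set f' := aeval (fun i => ∑ j, C (B i j) * X j) f with hf'
  set g' := aeval (fun i => ∑ j, C (B i j) * X j) g with hg'
  have hf'eval : ∀ y, eval y f' = eval (B *ᵥ y) f := fun y => eval_linSubst B y f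
  have hg'eval : ∀ y, eval y g' = eval (B *ᵥ y) g := fun y => eval_linSubst B y g
  have hlin1 : ∀ i : Fin 3, (∑ j, C (B i j) * X j : MvPolynomial (Fin 3) K).totalDegree ≤ 1 :=
    fun i => (isHomogeneous_linearForm (B i)).totalDegree_le
  have hdeg_f' : f'.totalDegree ≤ a := totalDegree_aeval_le_of_le_one _ hlin1 f
  have hdeg_g' : g'.totalDegree ≤ b := totalDegree_aeval_le_of_le_one _ hlin1 g
  have hrel' : IsRelPrime f' g' := isRelPrime_linSubst hBdet hrel
  /- Step C: the resultant with respect to `X₀`. -/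
  set F := finSuccEquiv K 2 f' with hF
  set G := finSuccEquiv K 2 g' with hG
  have hFdeg : F.natDegree ≤ a := by
    rw [hF, natDegree_finSuccEquiv]
    exact (degreeOf_le_totalDegree _ _).trans hdeg_f'
  have hGdeg : G.natDegree ≤ b := by
    rw [hG, natDegree_finSuccEquiv]
    exact (degreeOf_le_totalDegree _ _).trans hdeg_g'
  -- `F` has degree exactly `a`: `f'(t, 0, 0) = f(t c) = Σ_k t^k f_k(c)` has `t^a`-coefficient `fa(c) ≠ 0`
  have hFa : F.natDegree = a := by
    refine le_antisymm hFdeg ?_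
    set Q : Polynomial K := F.map (eval (0 : Fin 2 → K)) with hQ
    have hQeval : ∀ t : K, Q.eval t = eval (t • c) f := by
      intro t
      rw [hQ, hF, ← eval_eq_eval_mv_eval', hf'eval]
      congr 1
      have : (Fin.cons t (0 : Fin 2 → K) : Fin 3 → K) = t • (Pi.single 0 1 : Fin 3 → K) := by
        funext i
        refine Fin.cases ?_ (fun j => ?_) i
        · simp
        · simp [Fin.succ_ne_zero]
      rw [this, Matrix.mulVec_smul, hBcol]
    set P : Polynomial K := ∑ j ∈ range (a + 1),
      Polynomial.C (eval c (homogeneousComponent j f)) * Polynomial.X ^ j with hP_def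
    have hPeval : ∀ t : K, P.eval t = eval (t • c) f := by
      intro t
      conv_rhs => rw [← sum_homogeneousComponent f]
      rw [hP_def, Polynomial.eval_finsetSum, map_sum]
      refine Finset.sum_congr rfl fun j _ => ?_
      rw [Polynomial.eval_mul, Polynomial.eval_C, Polynomial.eval_pow, Polynomial.eval_X,
        eval_smul_of_isHomogeneous (homogeneousComponent_isHomogeneous j f), mul_comm]
    have hQP : Q = P := Polynomial.funext fun t => by rw [hQeval, hPeval]
    have hcoeff : Q.coeff a = eval c fa := by
      rw [hQP, hP_def, Polynomial.finsetSum_coeff, Finset.sum_eq_single a]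
      · rw [Polynomial.coeff_C_mul_X_pow, if_pos rfl]
      · intro j _ hja
        rw [Polynomial.coeff_C_mul_X_pow, if_neg (Ne.symm hja)]
      · intro h
        exact absurd (mem_range.2 (Nat.lt_succ_self a)) h
    have hQa : a ≤ Q.natDegree :=
      Polynomial.le_natDegree_of_ne_zero (by rw [hcoeff]; exact hca)
    exact hQa.trans Polynomial.natDegree_map_le
  have hF0 : F ≠ 0 := by
    intro h0
    rw [h0, Polynomial.natDegree_zero] at hFa
    exact ha0 hFa.symm
  set Rz := Polynomial.resultant F G a b with hRz
  have hRz0 : Rz ≠ 0 :=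
    resultant_ne_zero_of_isRelPrime hF0 hFa hGdeg
      (isRelPrime_map_mulEquiv (finSuccEquiv K 2).toMulEquiv hrel')
  have hcoefF : ∀ i, (F.coeff i).totalDegree ≤ a - i := by
    intro i
    by_cases hi : F.coeff i = 0
    · rw [hi, totalDegree_zero]; exact Nat.zero_le _
    · have := totalDegree_coeff_finSuccEquiv_add_le f' i hi
      rw [← hF] at this
      omega
  have hcoefG : ∀ i, (G.coeff i).totalDegree ≤ b - i := by
    intro i
    by_cases hi : G.coeff i = 0
    · rw [hi, totalDegree_zero]; exact Nat.zero_le _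
    · have := totalDegree_coeff_finSuccEquiv_add_le g' i hi
      rw [← hG] at this
      omega
  have hRzdeg : Rz.totalDegree ≤ a * b := totalDegree_resultant_le hcoefF hcoefG
  -- the projection `T z = (B⁻¹ z)₁,₂` along `c`
  set T : (Fin 3 → K) →ₗ[K] (Fin 2 → K) :=
    (LinearMap.funLeft K K Fin.succ).comp (Matrix.mulVecLin B⁻¹) with hT_def
  have hT : ∀ z, T z = Fin.tail (B⁻¹ *ᵥ z) := fun z => rfl
  have hBB : ∀ z, B *ᵥ (B⁻¹ *ᵥ z) = z := fun z => by
    rw [Matrix.mulVec_mulVec, Matrix.mul_nonsing_inv B hBdet, Matrix.one_mulVec]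
  -- common zeros of `f, g` project into `{Rz = 0}`
  have hRz_zero : ∀ z : Fin 3 → K, eval z f = 0 → eval z g = 0 → eval (T z) Rz = 0 := by
    intro z hzf hzg
    rw [hT]
    refine eval_resultant_eq_zero_of_common_zero hFdeg hGdeg (Or.inl ha0) (Fin.tail (B⁻¹ *ᵥ z))
      ((B⁻¹ *ᵥ z) 0) ?_ ?_
    · rw [hF, ← eval_eq_eval_mv_eval', Fin.cons_self_tail, hf'eval, hBB, hzf]
    · rw [hG, ← eval_eq_eval_mv_eval', Fin.cons_self_tail, hg'eval, hBB, hzg]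
  -- the kernel of `T` is the line `K c`
  have hker : ∀ z, T z = 0 → ∃ s : K, z = s • c := by
    intro z hz
    rw [hT] at hz
    refine ⟨(B⁻¹ *ᵥ z) 0, ?_⟩
    have hy : B⁻¹ *ᵥ z = (B⁻¹ *ᵥ z) 0 • (Pi.single 0 1 : Fin 3 → K) := by
      funext i
      refine Fin.cases ?_ (fun j => ?_) i
      · simp
      · have := congr_fun hz j
        rw [Fin.tail, Pi.zero_apply] at this
        rw [this]
        simp [Fin.succ_ne_zero]
    have hy' : B *ᵥ (B⁻¹ *ᵥ z) = (B⁻¹ *ᵥ z) 0 • c := by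
      conv_lhs => rw [hy]
      rw [Matrix.mulVec_smul, hBcol]
    rw [← hy', hBB]
  -- directions of lines of `Λ` do not project to `0`
  have hTw : ∀ ℓ ∈ Λ, T (uw ℓ).2 ≠ 0 := by
    intro ℓ hℓ h0
    obtain ⟨s, hs⟩ := hker _ h0
    have h := hψw ℓ hℓ
    rw [hs, dotProduct_smul, smul_eq_mul, mul_eq_zero] at h
    rcases h with hs0 | h
    · apply huw0 ℓ hℓ
      rw [hs, hs0, zero_smul]
    · exact hcψ ℓ hℓ h
  /- Step D: the projected lines. -/
  set proj : AffineSubspace K (Fin 3 → K) → AffineSubspace K (Fin 2 → K) :=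
    fun ℓ => AffineSubspace.mk' (T (uw ℓ).1) (K ∙ T (uw ℓ).2) with hproj_def
  have hproj : ∀ ℓ, proj ℓ = AffineSubspace.mk' (T (uw ℓ).1) (K ∙ T (uw ℓ).2) := fun ℓ => rfl
  have hproj_mem : ∀ ℓ x, x ∈ proj ℓ ↔ ∃ t : K, x = T (uw ℓ).1 + t • T (uw ℓ).2 := by
    intro ℓ x
    rw [hproj, AffineSubspace.mem_mk', Submodule.mem_span_singleton]
    constructor
    · rintro ⟨t, ht⟩
      refine ⟨t, ?_⟩
      rw [vsub_eq_sub] at ht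
      calc x = T (uw ℓ).1 + (x - T (uw ℓ).1) := by abel
        _ = T (uw ℓ).1 + t • T (uw ℓ).2 := by rw [ht]
    · rintro ⟨t, rfl⟩
      exact ⟨t, by rw [vsub_eq_sub]; abel⟩
  have hproj1 : ∀ ℓ ∈ Λ, Module.finrank K (proj ℓ).direction = 1 := by
    intro ℓ hℓ
    rw [hproj, AffineSubspace.direction_mk']
    exact finrank_span_singleton (hTw ℓ hℓ)
  have hprojR : ∀ ℓ ∈ Λ, ∀ x ∈ proj ℓ, eval x Rz = 0 := by
    intro ℓ hℓ x hx
    obtain ⟨t, rfl⟩ := (hproj_mem ℓ x).1 hx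
    have hz : (uw ℓ).1 + t • (uw ℓ).2 ∈ ℓ := (hmem ℓ hℓ _).2 ⟨t, rfl⟩
    have h := hRz_zero _ (hΛf ℓ hℓ _ hz) (hΛg ℓ hℓ _ hz)
    rwa [map_add, map_smul] at h
  /- Step E: distinct lines have distinct projections. -/
  have hinj : Set.InjOn proj ↑Λ := by
    intro ℓ hℓ m hm heq
    by_contra hne
    have hℓm : (ℓ, m) ∈ Λ.offDiag := Finset.mem_offDiag.2 ⟨hℓ, hm, hne⟩
    -- `T u_m - T u_ℓ` and `T w_m` are multiples of `T w_ℓ`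
    obtain ⟨β, hβ⟩ : ∃ β : K, T ((uw m).1 - (uw ℓ).1) = β • T (uw ℓ).2 := by
      have h1 : T (uw m).1 ∈ proj ℓ := by
        rw [heq]
        exact (hproj_mem m _).2 ⟨0, by rw [zero_smul, add_zero]⟩
      obtain ⟨β, hβ⟩ := (hproj_mem ℓ _).1 h1
      refine ⟨β, ?_⟩
      rw [map_sub, hβ]
      abel
    obtain ⟨α, hα⟩ : ∃ α : K, T (uw m).2 = α • T (uw ℓ).2 := by
      have hd : (proj m).direction = (proj ℓ).direction := by rw [heq]
      rw [hproj, hproj, AffineSubspace.direction_mk', AffineSubspace.direction_mk'] at hd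
      have h2 : T (uw m).2 ∈ K ∙ T (uw ℓ).2 := by
        rw [← hd]
        exact Submodule.mem_span_singleton_self _
      obtain ⟨α, hα⟩ := Submodule.mem_span_singleton.1 h2
      exact ⟨α, hα.symm⟩
    -- hence `w_m - α w_ℓ` and `u_m - u_ℓ - β w_ℓ` lie on the kernel line `K c`
    obtain ⟨s, hs⟩ := hker ((uw m).2 - α • (uw ℓ).2) (by rw [map_sub, map_smul, hα, sub_self])
    obtain ⟨s', hs'⟩ := hker ((uw m).1 - (uw ℓ).1 - β • (uw ℓ).2)
      (by rw [map_sub, map_smul, hβ, sub_self])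
    have hφc := hcφ (ℓ, m) hℓm
    simp only [hφ_def] at hφc
    by_cases hind : LinearIndependent K ![(uw ℓ).2, (uw m).2]
    · rw [if_pos hind] at hφc
      -- `φ = w_ℓ × w_m` is orthogonal to `w_m - α w_ℓ = s c`, so `s = 0`
      have h0 : ((uw ℓ).2 ⨯₃ (uw m).2) ⬝ᵥ ((uw m).2 - α • (uw ℓ).2) = 0 := by
        rw [dotProduct_sub, dotProduct_smul, dotProduct_comm _ (uw m).2, dot_cross_self,
          dotProduct_comm _ (uw ℓ).2, dot_self_cross, smul_zero, sub_zero]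
      rw [hs, dotProduct_smul, smul_eq_mul, mul_eq_zero] at h0
      rcases h0 with hs0 | h0
      · rw [hs0, zero_smul] at hs
        have h1 := (LinearIndependent.pair_iff.1 hind) (-α) 1
          (by rw [one_smul, neg_smul, ← sub_eq_neg_add]; exact hs)
        exact one_ne_zero h1.2
      · exact hφc h0
    · rw [if_neg hind] at hφc
      have hind' := hpar_ind ℓ hℓ m hm hne hind
      have h0 : ((uw ℓ).2 ⨯₃ ((uw m).1 - (uw ℓ).1)) ⬝ᵥ ((uw m).1 - (uw ℓ).1 - β • (uw ℓ).2) = 0 := by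
        rw [dotProduct_sub, dotProduct_smul, dotProduct_comm _ ((uw m).1 - (uw ℓ).1),
          dot_cross_self, dotProduct_comm _ (uw ℓ).2, dot_self_cross, smul_zero, sub_zero]
      rw [hs', dotProduct_smul, smul_eq_mul, mul_eq_zero] at h0
      rcases h0 with hs0 | h0
      · rw [hs0, zero_smul] at hs'
        -- `u_m - u_ℓ = β w_ℓ`: dependent, contradiction with `hind'`
        have h1 := (LinearIndependent.pair_iff.1 hind') (-β) 1
          (by rw [one_smul, neg_smul, ← sub_eq_neg_add]; exact hs')
        exact one_ne_zero h1.2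
      · exact hφc h0
  /- Step F: count. -/
  calc Λ.card = (Λ.image proj).card := (Finset.card_image_of_injOn hinj).symm
    _ ≤ Rz.totalDegree := by
        refine card_lines_le_totalDegree hRz0 _ ?_ ?_
        · simp only [Finset.mem_image]
          rintro _ ⟨ℓ, hℓ, rfl⟩
          exact hproj1 ℓ hℓ
        · simp only [Finset.mem_image]
          rintro _ ⟨ℓ, hℓ, rfl⟩ x hx
          exact hprojR ℓ hℓ x hx
    _ ≤ a * b := hRzdeg

end TwoSurfaces

end Literature.Combinatorics.Extremal
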